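import Summits.Ventures.QEC.Census.CertCoverBatch
import Summits.Ventures.QEC.Census.TwoBGA.TB_l6m24_A0_0_0_1_3_11_B0_0_1_11_5_4.CoreDefs
import HarnessLib

set_option Elab.async false
set_option maxRecDepth 200000

/-!
# `[[288,12,16]]` one-level cover certificate of `TB_l6m24_A0_0_0_1_3_11_B0_0_1_11_5_4` — LEVEL-1→0 coset problems 27…39 (deep problems [5] excluded: `ProbDeep*.lean`) as COMPACT data
(`ProbData`: U, f, σ, y₀, allow; qec-type-10 `CertCoverBatch.mkCoset` rebuilds each `CosetProb` in the kernel) + their verdict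
`probsOK cov covR hx hx1 D1 lxd 14` (one `decide +kernel`; 13 problems, depths f=0:8 f=1:4 f=2:1 f=3:0, est. 100.0 s).
qec-search-1 g5 (pattern of search-9 g5 `Probs*`); data from JSON `level10.problems` (sha256 fee0559d1bce5e88…). Data + decided check; KERNEL.
-/

namespace Summit.Ventures.QEC.Census.TB_l6m24_A0_0_0_1_3_11_B0_0_1_11_5_4

open Matrix Summit.Ventures.QEC.Census Literature.InformationTheory.QuantumCodes

/-- Problems 27…39 (13): `⟨U, f, σ, y₀, allow⟩`. -/
def probs03 : List ProbData := [
    ⟨1329877092323030743284869481892937728, 2, 2305843146653698048, 1329228055206042480968543127239393280, [0, 1]⟩,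
    ⟨1330201581195156906919184581642946560, 0, 442938030688682650628, 1329228025495495705363261800637792256, [0]⟩,
    ⟨1330201610867031928392456529818681345, 1, 216172782214447108, 1329228055206056648212106924317999105, [0]⟩,
    ⟨1330201610871853467886115625822062592, 0, 2305843146653698048, 1329228055206042480968543127239393280, [0]⟩,
    ⟨1330526109710359664519787030308196352, 0, 892361807657398452226, 1298074311348367383799610071846912, [0]⟩,
    ⟨1330526129420685637220327509041610755, 1, 6917529302522134528, 1329228055206051925701508866529820675, [0]⟩,
    ⟨1330526129430385375958529402259636224, 0, 2738188711082592264, 1298074224305115769892941572603904, [0]⟩,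
    ⟨1331175146817700125482311773553954818, 0, 885876624469061025802, 1329228035399034909256632144748347394, [0]⟩,
    ⟨1331175166528026098182852802043183105, 1, 432345564428894216, 1947111321950560360699211001364480, [0]⟩,
    ⟨1331175166537669177170170994049941506, 0, 4611686430746347520, 1947111331621973835144997165334528, [0]⟩,
    ⟨1331824173963458494365323087182825476, 0, 456556916511512472576, 1331824173924744238790852418929164288, [0]⟩,
    ⟨1331824203635333515838594760489041925, 1, 13835058605044269056, 1329228055206066092800957475465461765, [0]⟩,
    ⟨1331824203635512974988598418874564617, 0, 27670117210893852704, 1331824203635305190863352153948291073, [0]⟩]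

set_option maxHeartbeats 400000000 in
/-- Every problem of this chunk passes (`mkCoset` elimination + `cosetOKD` + fast `σ` + depth + `BU`-evenness + label checks). -/
theorem probs03_ok : probsOK TB_l6m24_A0_0_0_1_3_11_B0_0_1_11_5_4.cov covR hx hx1 D1 lxd 14 probs03 = true := by
  decide +kernel

/-- Pointwise form. -/
theorem probs03_all : ∀ x ∈ TB_l6m24_A0_0_0_1_3_11_B0_0_1_11_5_4.probs03, probOK cov covR hx hx1 D1 lxd 14 x = true := by
  have h := probs03_ok
  rwa [probsOK, List.all_eq_true] at h

end Summit.Ventures.QEC.Census.TB_l6m24_A0_0_0_1_3_11_B0_0_1_11_5_4
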